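import Summits.MatrixMultiplication.MatrixMultiplication.Theses.ToricBorderRank

/-!
# MatrixMultiplication / ToricBorderRank — `ToricDegeneration` (stmt-MatrixMultiplication-9966)

Route `ToricBorderRank`, support item `ToricDegeneration` — THE DEGENERATION LEMMA
(Bürgisser–Clausen–Shokrollahi 1997, Prop. 15.30, for the coordinate decomposition, read
backwards; Bläser 2013, Def. 6.1): over any commutative ring `K` and finite formats, if integer
weights `α, β, γ` vanish on the support of `M` (W0) and `T = M` on every cell of weight `≤ 0`
(W1), then `bR(M) ≤ R(T)` for the algebraic border rank `algBorderRank` over `K[ε]`.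

Proof (as in the item text): take an optimal exact decomposition `T = ∑_ρ w_ρ ⊗ u_ρ ⊗ v_ρ`
with `r = R(T)` triads, shift the weights to natural numbers `α' = α + n_α`, `β' = β + n_β`,
`γ' = γ + n_γ` (`n_α ≥ -min α`, …) and scale every coordinate by the corresponding power of `ε`:
`U_ρ(a) = w_ρ(a) ε^{α'(a)}`, `V_ρ(b) = u_ρ(b) ε^{β'(b)}`, `W_ρ(c) = v_ρ(c) ε^{γ'(c)}`. Entrywise
`∑_ρ U_ρ(a) V_ρ(b) W_ρ(c) = T_{abc} ε^{α(a)+β(b)+γ(c)+h}` with `h = n_α + n_β + n_γ`, so the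
coefficient in degree `h` is `T_{abc} = M_{abc}` on weight-`0` cells and `0 = M_{abc}` elsewhere
(W0), and the coefficients below degree `h` come from negative-weight cells, where
`T_{abc} = M_{abc} = 0` (W1, W0): an order-`h` approximate decomposition of `M` with `r` triads,
whence `bR(M) ≤ R_h(M) ≤ r = R(T)`.
-/

-- the tree's namespace `Summit.MatrixMultiplication.MatrixMultiplication.…` repeats a component by design
set_option linter.dupNamespace false

noncomputable section

open scoped BigOperators Polynomial

namespace Summit.MatrixMultiplication.MatrixMultiplication.Theorems

open Literature.Computability.AlgebraicComplexity

universe u v₁ v₂ v₃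

section Toric

variable {K : Type u} [CommSemiring K] {ι : Type v₁} {κ : Type v₂} {μ : Type v₃}

/-- **Toric scaling of an exact decomposition** (BCS 1997, Prop. 15.30 read backwards, in
Bläser's `K[ε]` language): if `T = ∑_ρ w_ρ ⊗ u_ρ ⊗ v_ρ` exactly, natural-number weights
`α', β', γ'` and an order `h` satisfy (W0') `M_{abc} ≠ 0 → α' a + β' b + γ' c = h` and
(W1') `α' a + β' b + γ' c ≤ h → T_{abc} = M_{abc}`, then scaling the coordinates by
`ε^{α'}, ε^{β'}, ε^{γ'}` gives an order-`h` approximate decomposition of `M` with the same `r`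
triads. -/
theorem isApproxDecomposition_toricScaling [Fintype ι] [Fintype κ] [Fintype μ]
    {M T : ι → κ → μ → K} {r : ℕ} {w : Fin r → ι → K} {u : Fin r → κ → K} {v : Fin r → μ → K}
    (hT : T = ∑ i, triad (w i) (u i) (v i)) (α' : ι → ℕ) (β' : κ → ℕ) (γ' : μ → ℕ) (h : ℕ)
    (h0 : ∀ a b c, M a b c ≠ 0 → α' a + β' b + γ' c = h)
    (h1 : ∀ a b c, α' a + β' b + γ' c ≤ h → T a b c = M a b c) :
    IsApproxDecomposition h M (fun ρ a => Polynomial.C (w ρ a) * Polynomial.X ^ α' a)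
      (fun ρ b => Polynomial.C (u ρ b) * Polynomial.X ^ β' b)
      (fun ρ c => Polynomial.C (v ρ c) * Polynomial.X ^ γ' c) := by
  intro a b c j hj
  -- entrywise the sum is the monomial `T_{abc} ε^{e}`, `e = α' a + β' b + γ' c`
  have hTabc : T a b c = ∑ ρ, w ρ a * u ρ b * v ρ c := by
    rw [hT, Finset.sum_apply, Finset.sum_apply, Finset.sum_apply]
    rfl
  have hsum : (∑ ρ, (Polynomial.C (w ρ a) * Polynomial.X ^ α' a) *
      (Polynomial.C (u ρ b) * Polynomial.X ^ β' b) * (Polynomial.C (v ρ c) * Polynomial.X ^ γ' c)) =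
      Polynomial.C (T a b c) * Polynomial.X ^ (α' a + β' b + γ' c) := by
    rw [hTabc, map_sum, Finset.sum_mul]
    refine Finset.sum_congr rfl fun ρ _ => ?_
    simp only [map_mul, pow_add]
    ring
  rw [hsum, Polynomial.coeff_C_mul_X_pow]
  by_cases hje : j = α' a + β' b + γ' c
  · rw [if_pos hje]
    by_cases hjh : j = h
    · rw [if_pos hjh]
      exact h1 a b c (by omega)
    · rw [if_neg hjh]
      have hM : M a b c = 0 := by
        by_contra hne
        exact hjh (hje.trans (h0 a b c hne))
      rw [h1 a b c (by omega), hM]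
  · rw [if_neg hje]
    by_cases hjh : j = h
    · rw [if_pos hjh]
      by_contra hne
      exact hje (hjh.trans (h0 a b c (Ne.symm hne)).symm)
    · rw [if_neg hjh]

/-- **The degeneration lemma with natural-number weights**: under (W0'), (W1') of
`isApproxDecomposition_toricScaling`, `bR(M) ≤ R(T)` (finite formats). -/
theorem algBorderRank_le_tensorRank_of_natWeights [Fintype ι] [Fintype κ] [Fintype μ]
    [DecidableEq ι] [DecidableEq κ] [DecidableEq μ] (M T : ι → κ → μ → K)
    (α' : ι → ℕ) (β' : κ → ℕ) (γ' : μ → ℕ) (h : ℕ)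
    (h0 : ∀ a b c, M a b c ≠ 0 → α' a + β' b + γ' c = h)
    (h1 : ∀ a b c, α' a + β' b + γ' c ≤ h → T a b c = M a b c) :
    algBorderRank M ≤ tensorRank T := by
  -- an optimal exact decomposition of `T`, via `R_0(T) = R(T)`
  obtain ⟨U, V, W, hUVW⟩ := exists_isApproxDecomposition_approxRank 0 T
  have hT := eq_sum_triad_of_isApproxDecomposition_zero hUVW
  calc algBorderRank M ≤ approxRank h M := algBorderRank_le_approxRank h M
    _ ≤ approxRank 0 T :=
        approxRank_le_of_isApproxDecomposition
          (isApproxDecomposition_toricScaling hT α' β' γ' h h0 h1)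
    _ = tensorRank T := approxRank_zero T

/-- **The degeneration lemma with integer weights** (the form of the route item): if integer
weights vanish on `supp M` (W0) and `T = M` on all cells of weight `≤ 0` (W1), then
`bR(M) ≤ R(T)`; reduce to natural-number weights by adding to each weight function a natural
number dominating its negative part. -/
theorem algBorderRank_le_tensorRank_of_intWeights [Fintype ι] [Fintype κ] [Fintype μ]
    [DecidableEq ι] [DecidableEq κ] [DecidableEq μ] (M T : ι → κ → μ → K)
    (α : ι → ℤ) (β : κ → ℤ) (γ : μ → ℤ)
    (h0 : ∀ a b c, M a b c ≠ 0 → α a + β b + γ c = 0)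
    (h1 : ∀ a b c, α a + β b + γ c ≤ 0 → T a b c = M a b c) :
    algBorderRank M ≤ tensorRank T := by
  -- shifts making the weights non-negative (`Finset.sup` over `ℕ`: `0` on an empty index type)
  set nα : ℕ := Finset.univ.sup fun a => (-α a).toNat with hnα
  set nβ : ℕ := Finset.univ.sup fun b => (-β b).toNat with hnβ
  set nγ : ℕ := Finset.univ.sup fun c => (-γ c).toNat with hnγ
  have hαn : ∀ a, 0 ≤ α a + nα := fun a => by
    have : (-α a).toNat ≤ nα := Finset.le_sup (f := fun a => (-α a).toNat) (Finset.mem_univ a)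
    omega
  have hβn : ∀ b, 0 ≤ β b + nβ := fun b => by
    have : (-β b).toNat ≤ nβ := Finset.le_sup (f := fun b => (-β b).toNat) (Finset.mem_univ b)
    omega
  have hγn : ∀ c, 0 ≤ γ c + nγ := fun c => by
    have : (-γ c).toNat ≤ nγ := Finset.le_sup (f := fun c => (-γ c).toNat) (Finset.mem_univ c)
    omega
  refine algBorderRank_le_tensorRank_of_natWeights M T (fun a => (α a + nα).toNat)
    (fun b => (β b + nβ).toNat) (fun c => (γ c + nγ).toNat) (nα + nβ + nγ) ?_ ?_
  · intro a b c hM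
    have := h0 a b c hM
    have ha := Int.toNat_of_nonneg (hαn a)
    have hb := Int.toNat_of_nonneg (hβn b)
    have hc := Int.toNat_of_nonneg (hγn c)
    omega
  · intro a b c hle
    have ha := Int.toNat_of_nonneg (hαn a)
    have hb := Int.toNat_of_nonneg (hβn b)
    have hc := Int.toNat_of_nonneg (hγn c)
    exact h1 a b c (by omega)

end Toric

/-- **`ToricDegeneration`** (route ToricBorderRank, stmt-MatrixMultiplication-9966; BCS 1997,
Prop. 15.30 read backwards): over any commutative ring and finite formats, integer weights
vanishing on `supp M` (W0) and an honest `T` agreeing with `M` on the closed negative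
half-space (W1) give `algBorderRank M ≤ tensorRank T`. -/
theorem toricDegeneration_proof :
    Summit.MatrixMultiplication.MatrixMultiplication.Theses.ToricBorderRank.ToricDegeneration := by
  unfold Summit.MatrixMultiplication.MatrixMultiplication.Theses.ToricBorderRank.ToricDegeneration
  intro K _ ι κ μ _ _ _ _ _ _ M T α β γ h0 h1
  exact algBorderRank_le_tensorRank_of_intWeights M T α β γ h0 h1

end Summit.MatrixMultiplication.MatrixMultiplication.Theorems

end
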